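import Mathlib
import HarnessLib
import HarnessLib.Audit
import Summits.CriticalPhenomena.Statement
import Literature.Probability.LatticeModels.LatticeGreenFunction
import Literature.Probability.LatticeModels.ProdBernoulliIndependence

/-!
Route: PercLupuEnvironment

DORMANT since 2026-08-29T05:47:42Z (reconciler: no traction for 5 d (last activity statement-closed at 2026-08-24T03:51:29Z); parked, not closed — `ledger route dormant route-CriticalPhenomena-PercLupuEnvironment --off` to reactivate) — unstaffed, not closed; items shared with open routes are served there. `ledger route dormant <id> --off` reactivates.

# Route PercLupuEnvironment — Bernoulli(p_c) on Z^3 as the zero-disorder end of Lupu's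
GFF-environment family — subcritical stability plus uniform one-arm decay through the crossover

It suffices to show X = G1 ∧ T1 for the LUPU FAMILY of Bernoulli bond percolations on ℤ³ in a
Gaussian-free-field environment
(card CriticalPhenomena/PercolationContinuityZ3/lupu-environment-integrable-point, spine): given the
discrete GFF g of ℤ³ (centred Gaussian,
E g_x g_y = latticeGreen(x−y)/2 = (−L)⁻¹(x,y), L f(x) = Σ_{y∼x}(f_y − f_x)), open each bond xy of ℤ³
independently with probability
p_xy(σ,m) = 1 − exp(−2 (m+σg_x)⁺ (m+σg_y)⁺). At σ = 0 this is Bernoulli(1−e^{−2m²}) EXACTLY, so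
Bernoulli(p_c) is the point (0, a_c),
a_c = (−log(1−p_c)/2)^{1/2} ≈ 0.378; at σ = 1 it is the vertex trace of the cable-GFF level set {φ̃
> −m} (Lupu's identity), critical and
SOLVED at m = 0 (θ = 0, one-arm ≍ n^{−1/2}). G1 = SubcriticalDisorderStability: for a with
1−e^{−2a²} < p_c(ℤ³) the annealed model (σ, a)
does not percolate for all small σ > 0. T1 = UniformSubcriticalOneArm: there are σ₀ > 0 and, for
each ε > 0, one scale n at which the annealed
one-arm probability E P^{m+σg}(0 ↔ ∂B(n) in B(n)) is ≤ ε at every NON-percolating (σ, m) with 0 < σ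
≤ σ₀.
Lean: `(let W : (Literature.Probability.LatticeModels.Site 3 → ℝ) → Sym2
(Literature.Probability.LatticeModels.Site 3) → unitInterval := fun ψ e => if e ∈
(Literature.Probability.LatticeModels.zdGraph 3).edgeSet then Set.projIcc (0 : ℝ) 1 zero_le_one (1 -
Real.exp (-2 * (e.map fun x => max (ψ x) 0).mul)) else 0; ∀ (Ω : Type) [MeasurableSpace Ω] (P :
MeasureTheory.Measure Ω) [MeasureTheory.IsProbabilityMeasure P] (g :
Literature.Probability.LatticeModels.Site 3 → Ω → ℝ), ProbabilityTheory.IsGaussianProcess g P → (∀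
x, ∫ ω, g x ω ∂P = 0) → (∀ x y, ∫ ω, g x ω * g y ω ∂P =
Literature.Probability.LatticeModels.latticeGreen (d := 3) (x - y) / 2) → ∀ a : ℝ, 0 < a → 1 -
Real.exp (-2 * a ^ 2) < Literature.Probability.Percolation.criticalProb
(Literature.Probability.LatticeModels.zdGraph 3) (0 : Literature.Probability.LatticeModels.Site 3) →
∃ σ₁ : ℝ, 0 < σ₁ ∧ ∀ σ : ℝ, 0 < σ → σ < σ₁ → ∫ ω,
(Literature.Probability.LatticeModels.prodBernoulli (W (fun x => a + σ * g x ω))).real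
(Literature.Probability.Percolation.percolatesAt (0 : Literature.Probability.LatticeModels.Site 3))
∂P = 0) ∧ (let W : (Literature.Probability.LatticeModels.Site 3 → ℝ) → Sym2
(Literature.Probability.LatticeModels.Site 3) → unitInterval := fun ψ e => if e ∈
(Literature.Probability.LatticeModels.zdGraph 3).edgeSet then Set.projIcc (0 : ℝ) 1 zero_le_one (1 -
Real.exp (-2 * (e.map fun x => max (ψ x) 0).mul)) else 0; ∀ (Ω : Type) [MeasurableSpace Ω] (P :
MeasureTheory.Measure Ω) [MeasureTheory.IsProbabilityMeasure P] (g :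
Literature.Probability.LatticeModels.Site 3 → Ω → ℝ), ProbabilityTheory.IsGaussianProcess g P → (∀
x, ∫ ω, g x ω ∂P = 0) → (∀ x y, ∫ ω, g x ω * g y ω ∂P =
Literature.Probability.LatticeModels.latticeGreen (d := 3) (x - y) / 2) → ∃ σ₀ : ℝ, 0 < σ₀ ∧ ∀ ε :
ℝ, 0 < ε → ∃ n : ℕ, ∀ σ : ℝ, 0 < σ → σ ≤ σ₀ → ∀ m : ℝ, ∫ ω,
(Literature.Probability.LatticeModels.prodBernoulli (W (fun x => m + σ * g x ω))).real
(Literature.Probability.Percolation.percolatesAt (0 : Literature.Probability.LatticeModels.Site 3))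
∂P = 0 → ∫ ω, (Literature.Probability.LatticeModels.prodBernoulli (W (fun x => m + σ * g x ω))).real
(Literature.Probability.Percolation.siteToBoundary 3 n) ∂P ≤ ε)`

## Assembly
Elementary given the items: fix ε > 0 and a GFF (GFFExists). T1 gives σ₀ and then a scale n. Let p_c
= p_c(ℤ³) ∈ (0,1)
(Grimmett1999_criticalProb_pos_lt_one_holds, proved in the tree) and a_c = (−log(1−p_c)/2)^{1/2}.
For 0 < a < a_c (i.e. 1−e^{−2a²} < p_c) G1 gives
σ₁; for 0 < σ < min(σ₀, σ₁) the point (σ, a) is non-percolating, so T1 bounds E P^{a+σg}(0 ↔ ∂B(n)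
in B(n)) ≤ ε; let σ → 0⁺ (LocalContinuityAtZero)
and rewrite the constant field as Bernoulli (ConstantFieldIsBernoulli): P_p(0 ↔ ∂B(n) in B(n)) ≤ ε
for every p = 1−e^{−2a²}, i.e. for all
p ∈ (0, p_c); continuity in p (OneArmContinuousInP) and p_c > 0 give P_{p_c}(0 ↔ ∂B(n) in B(n)) ≤ ε;
finally θ(p_c) ≤ P_{p_c}(0 ↔ ∂B(n) in B(n))
(Literature DCT16.theta_le_real_siteToBoundary, proved) ≤ ε for every ε > 0, so θ(p_c) = 0.

Rationale: WHY THIS LINE. Lupu's coupling (doi:10.1214/15-aop1019, Prop. 4.2 and the display on p. 14: given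
the discrete GFF, cable sign clusters are independent
bonds open with probability 1_{ψ_xψ_y>0}(1−e^{−2Cψ_xψ_y})) makes the ONE three-dimensional critical
percolation that is rigorously continuous
with known exponents — cable-GFF level sets on ℤ̃³ (doi:10.1214/15-aop1019 Prop. 5.5 and Thm 3: h̃_*
= 0 with bounded sign clusters at 0;
doi:10.1007/s00440-025-01392-7 Thm 1.1: one-arm ψ(R) ≍ R^{−1/2} on ℤ³) — literally an inhomogeneous
Bernoulli bond percolation on ℤ³, and
Bernoulli(p_c) the constant-environment member of the same formula. In the chart (κ, h) = (σ², m/σ)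
the family p = 1−e^{−2κ(g_x+h)⁺(g_y+h)⁺} is
stochastically increasing in BOTH parameters (item RayMonotone) and its κ → ∞ end is discrete-GFF
level-set percolation, so Bernoulli(p_c)
(corner κ → 0, κh² → a_c²), the solved cable GFF (κ = 1) and the discrete GFF (κ = ∞; sharpness
doi:10.1215/00127094-2022-0017, continuity
open) sit on one monotone phase diagram with critical curve h_c(κ) ↓, h_c(1) = 0. Physics puts every
σ > 0 in the long-range class LR_{a=1}:
GFF disorder has correlation exponent a = d−2 = 1 < 2/ν_Bernoulli ≈ 2.28, hence is RELEVANT at p_c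
(Weinrib–Halperin doi:10.1103/PhysRevB.27.413),
and the exact LR_a exponents ν = 2/a = 2, one-arm a/2 = 1/2, η = 0 are rigorous for the cable GFF
and numerically shared by discrete GFF and
interlacement vacant set (Chalhoub–Drewitz–Prévost–Rodriguez arXiv:2403.18787, Table I and p. 5, who
name "the crossover to short range
universality classes" as the open question); σ → 0 along the critical curve IS that crossover and
ends at the conjunct. The route files exactly
the two transfer statements this picture needs: stability of the subcritical phase under vanishing
GFF disorder (G1 — a renormalisation /
decoupling problem in the technology of doi:10.1007/s00220-012-1649-y,
doi:10.1007/s10955-015-1187-z) and uniform smallness of the subcritical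
one-arm probability near σ = 0 (T1 — the crossover estimate, anchored at the solved end). Imported:
isomorphism theorems and potential theory of
the GFF (probability) and disorder relevance / crossover scaling (statistical physics) with the
explicit dictionary p ↔ field level m,
sprinkling ↔ level or coupling shift, universality class ↔ LR_a table; no existing route of this
sub-problem (PercTwoPointDecay,
PercAnnulusCrossing, PercFiniteBoxLRO, PercLowPointHalfSpace, PercLevyKhintchine, PercDebrisSweep,
PercTruncatedSusceptibility, PercOpenSupercrit)
deforms the MODEL to a solved one — all work inside Bernoulli(p).

RANKED CRUXES. #2 UniformSubcriticalOneArm (crux) — (T1; the card's transfer crux N2 in one-arm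
currency) for every discrete GFF g of ℤ³ there is σ₀ > 0 such that for every ε > 0 some scale n
satisfies: for all 0 < σ ≤ σ₀ and all m with annealed θ(σ,m) = E P^{m+σg}(|C(0)| = ∞) = 0, the
annealed one-arm probability E P^{m+σg}(0 ↔ ∂B(n) in B(n)) is ≤ ε. Equivalently the one-arm
probability at the left end m ↑ m_c(σ) of the critical curve tends to 0 uniformly in σ ≤ σ₀:
continuity of the transition at every small disorder strength, uniformly through the crossover. For
m ≤ 0 it already follows from RayMonotone + SolvedEndAnchor (P_{σ,m} ≤_st cable level set at level
−m/σ ≥ 0, one-arm ≤ C n^{−1/2}); the content is 0 < m < m_c(σ). [difficulty: open-problem] (why it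
might fail: Contains continuity of the transition at EVERY small σ>0 — open even for discrete-GFF
level sets (DGRS 2023 prove sharpness only) — plus equicontinuity through the LR→SR crossover σ→0,
i.e. the conjunct in disguise; rigorous only at σ=1 (Lupu 2016, DPR 2025).) [doi:10.1214/15-aop1019,
doi:10.1007/s00440-025-01392-7, arXiv:2403.18787, doi:10.1103/PhysRevB.27.413,
doi:10.1215/00127094-2022-0017]
#3 SubcriticalDisorderStability (crux) — (G1) for every discrete GFF g of ℤ³ and every a > 0 with 1
− e^{−2a²} < p_c(ℤ³) there is σ₁ > 0 such that for all 0 < σ < σ₁ the annealed Lupu model with field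
a + σg does not percolate: E P^{a+σg}(|C(0)| = ∞) = 0. In words: weak GFF disorder cannot make
subcritical Bernoulli percolation percolate, liminf_{σ→0} m_c(σ) ≥ a_c — the σ → 0 end of the
critical curve does not undershoot p_c. Intended proof: coarse-grain at scale L; blocks where sup
σ|g| > δ are GFF large-deviation rare (capacity cost ~ δ²L/(σ² log L)) and sprinkled-decoupled;
elsewhere densities stay ≤ 1−e^{−2(a+δ)²} < p_c; a multiscale "subcritical sea + sparse finite
islands" argument. [difficulty: L] (why it might fail: GFF excursions are unbounded and
1/|x|-correlated: for every σ>0 supercritical islands {a+σg>a_c+δ} of ALL sizes exist; fat-tailed or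
columnar defects do shift thresholds (Boolean model with Eρ^d=∞, Meester–Roy Prop. 3.1; Brochette
percolation arXiv:1608.04505).) [doi:10.1007/s00220-012-1649-y, doi:10.1007/s10955-015-1187-z,
book:meester1996-continuum-percolation, arXiv:1608.04505, AizenmanGrimmett1991, Grimmett1999]
#9 LocalContinuityAtZero (support) — for every GFF g, every a ∈ ℝ and n ∈ ℕ: σ ↦ E P^{a+σg}(0 ↔
∂B(n) in B(n)) tends, as σ → 0⁺, to P^{a}(0 ↔ ∂B(n) in B(n)) (constant field). Dominated
convergence: the event is local, its quenched probability is a polynomial in finitely many weights,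
each continuous in the field values. [difficulty: provable-now] [Grimmett1999]
#9 ConstantFieldIsBernoulli (support) — the constant field a gives Bernoulli bond percolation on ℤ³
with parameter 1 − e^{−2 a⁺a⁺}: prodBernoulli of the Lupu weights of the constant field equals
bondPercolation (zdGraph 3) (1 − e^{−2 a⁺ a⁺}) (via Literature prodBernoulli_indicator_holds).
[difficulty: provable-now] [doi:10.1214/15-aop1019, Grimmett1999]
#9 OneArmContinuousInP (support) — for each n, p ↦ P_p(0 ↔ ∂B(n) in B(n)) is continuous on [0,1]
(local increasing event: a polynomial in p). [difficulty: provable-now] [Grimmett1999]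
#9 GFFExists (support) — some probability space carries a centred Gaussian process (g_x), x ∈ ℤ³,
with E g_x g_y = latticeGreen(x−y)/2 — the discrete GFF of ℤ³ with unit conductances (latticeGreen/2
= (−L)⁻¹ is positive definite by its Fourier representation with symbol 1/(2Σᵢ(1−cos kᵢ)); construct
g_x = Σ_y K(x−y)ξ_y with K̂ = Ĝ^{1/2} ∈ L²(𝕋³) and ξ i.i.d. N(0,1), or by Kolmogorov extension).
Makes the ∀-quantified cruxes non-vacuous; used by the assembly. [difficulty: M]
[doi:10.1007/s00220-012-1649-y, doi:10.1214/15-aop1019]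
#9 RayMonotone (support) — (structure of the family) for every field ψ, every c ≥ 1, t ≥ 0 and every
increasing measurable event A: P^{W(ψ)}(A) ≤ P^{W(cψ+t)}(A), because the Lupu weights
1−e^{−2ψ_x⁺ψ_y⁺} are pointwise monotone under ψ ↦ cψ + t (prodBernoulli_real_mono_of_isUpperSet).
Hence in the chart (κ,h) = (σ², m/σ) the family is increasing in both parameters, m_c(σ) ≥ 0 on
(0,1], and P_{σ,m} ≤_st (cable level set at level −m/σ) for σ ≤ 1. [difficulty: provable-now]
[doi:10.1214/15-aop1019, Grimmett1999]
#9 SolvedEndAnchor (support) — (calibration of the formal model against the solved end σ = 1) for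
every GFF g: (i) annealed θ(1,0) = 0 (Lupu 2016 Prop. 5.5: the sign clusters of the cable GFF of
ℤ̃^d, d ≥ 3, are bounded); (ii) θ(1,m) > 0 for every m > 0 (Lupu 2016 Thm 3, DPR 2018 (1.10): {φ̃ ≥
−h} percolates for h > 0); (iii) E P^{g}(0 ↔ ∂B(n) in B(n)) ≤ C n^{−1/2} (Drewitz–Prévost–Rodriguez
2025 Thm 1.1 with ν = 1; Ding–Wirth 2020 with a log). A refutation would mean the Lean rendering of
the family is wrong (repair by restate), not that the line is dead; a proof needs the isomorphism
theory in Literature (cite requests below). [difficulty: XL] [doi:10.1214/15-aop1019,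
doi:10.1007/s00220-018-3209-6, doi:10.1007/s00440-025-01392-7, doi:10.1214/19-aop1397]

TWO-LAYER PLAN. Foreseen glued splits (nothing filed now). T1 ⇐ ContinuityAtPositiveDisorder (for
each fixed σ ∈ (0,σ₀]: the one-arm probability at the left end of
the critical curve tends to 0 — LR-class continuity, the σ < 1 analogue of Lupu's theorem) →
CrossoverEquicontinuity (ContinuityAtPositiveDisorder → T1:
uniformity as σ → 0, the crossover estimate proper) → T1. G1 ⇐ IslandSparsity (for δ, L: for σ < σ₁
the L-blocks with sup σ|g| > δ contain no infinite
*-chain and have stretched-exponentially decaying chain connectivity — GFF local-sup large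
deviations + sprinkled decoupling) → SubcriticalSeaNoPercolation
(Bernoulli at densities ≤ 1−e^{−2(a+δ)²} < p_c plus ARBITRARY states on a block set with that
sparsity does not percolate) → G1.

KILL CRITERIA. ¬G1 (weak GFF disorder makes a fixed subcritical a < a_c percolate for arbitrarily
small σ, i.e. liminf m_c(σ) < a_c): close `refuted:SubcriticalDisorderStability`
— no transfer along the Lupu family can then land at p_c. ¬T1 exhibited at a FIXED σ ≤ any σ₀ (a
discontinuous transition somewhere on the family at small
disorder, or a non-decaying critical one-arm probability) closes the route
`refuted:UniformSubcriticalOneArm`; ¬T1 only through the σ → 0 limit is the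
conjunct's negation in disguise and is handed to the negative side. A refutation of SolvedEndAnchor
or ConstantFieldIsBernoulli means the Lean rendering
of the family is mis-specified: repair by `--restate` (same mathematics), not a close. θ(p_c) = 0
proved on any other route moots this one; a proof of
continuity for DISCRETE-GFF level sets (κ = ∞) elsewhere upgrades T1's first layer from bet to
template.

NOT DECOMPOSED YET. The crossover scale ξ_×(σ) ~ σ^{−2ν/φ} (φ = 2/ν − a ≈ 1.28) and any quantitative
rate n^{−κ} in T1; the card's two-point / ball-sum currency (Σ_{Λ_r} τ ≤ C r^{3−a}
uniformly, via τ ≥ θ² and lower semicontinuity) as an alternative to the one-arm currency; sharpness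
along the family for σ < 1 (DGRS-type); the
supercritical side limsup m_c(σ) ≤ a_c (not needed); the κ → ∞ (discrete GFF) end and the κ > 1
comparison; the massive family F_{mass,h} of the card
(its only solved point is the same corner — Prévost doi:10.1214/23-ejp949 has h̃_* < 0 for massive
cable systems — so it is dropped).

CHEAPEST FALSIFIER. Run here already (quadrature, NOTES.md): the annealed edge density of the
critical cable model is p̄(σ=1, m=0) = E[1−e^{−2g_x⁺g_y⁺}] = 0.0849 < 1/5 ≤ p_c(ℤ³ bond),
so NO stochastic domination between Bernoulli(p_c) and the solved model exists in either useful
direction — the card's comparison question Q1 is answered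
negatively and every domination variant is excluded from this route (only transfer statements are
filed). For the filed line the cheapest check is a kit
Monte Carlo of the Lupu family on tori L = 32…128 at σ ∈ {0.05, 0.1, 0.2, 0.5, 1}: (a) locate m_c(σ)
— it must stay ≥ 0, equal 0 at σ = 1, and extrapolate
to a_c = 0.3782 as σ → 0 (an extrapolated limit below a_c refutes G1); (b) the one-arm decay at
m_c(σ): exponents ≈ 0.48 (Bernoulli window) to 0.5 (LR_1)
are expected at all σ; a plateau of P(0 ↔ ∂B(n)) developing as σ ↓ would be the finite-size shadow
of ¬T1. Lookup falsifier: any theorem making p_c strictly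
unstable under vanishing-density FINITE enhancements (none found; Aizenman–Grimmett essential
enhancements need positive density).

NUMBERS. p_c(ℤ³ bond) = 0.2488126 (numerics; rigorous 1/(2d−1) = 1/5 ≤ p_c); a_c =
(−log(1−p_c)/2)^{1/2} = 0.37822; GFF of ℤ³ (unit conductances):
G(0,0) = latticeGreen(0)/2 = 0.25273 (sd 0.5027), G(0,e₁) = 0.08606, ρ = 0.3405; annealed densities
p̄(1,0) = 0.0849, p̄(1,a_c) = 0.2726,
p̄(σ, a_c) = p_c − 0.0163 σ² + o(σ²); along the segment (σ, (1−σ)a_c): 0.2488, 0.1521, 0.1034,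
0.0890, 0.0849 at σ = 0, ¼, ½, ¾, 1.
One-arm exponents: Bernoulli ℤ³ β/ν = d − d_f ≈ 0.477, cable GFF 1/2 exactly
(doi:10.1007/s00440-025-01392-7); ν: 0.876 vs 2 = 2/a;
LR_1 table (arXiv:2403.18787, a = 1, d = 3): β = 1, γ = 4, δ = 5, ν = 2, η = 0, α = −4;
Weinrib–Halperin: a = 1 < 2/ν_Bernoulli = 2.28 (relevant),
crossover exponent φ = 2/ν − a ≈ 1.28. Items at open: 9 (2 cruxes, 6 support, 1 assembly).

DEFINITION REQUESTS. D1 `IsDiscreteGFF` (topic Literature/Probability/LatticeModels): predicate on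
(Ω, P, g : Site d → Ω → ℝ) = IsGaussianProcess ∧ centred ∧
E g_x g_y = latticeGreen(x−y)/2, with the existence theorem (would discharge GFFExists and shorten
every signature). D2 `lupuWeight`
(ψ : Site d → ℝ) : Sym2 (Site d) → unitInterval, = 1−exp(−2ψ_x⁺ψ_y⁺) on edges of zdGraph d, 0 off
them, and the annealed Lupu-family functionals
θ(σ,m), one-arm(σ,m,n) (same topic) — today each item carries them as a `let W := …` prefix; once
D1/D2 land the items are restated verbatim without it.
Cite facts wanted (family crit-ising, trunk Probability/LatticeModels): Lupu2016 =
doi:10.1214/15-aop1019 Prop. 5.5 + Thm 3 (cable h̃_* = 0, no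
percolation at 0, Prop. 4.2 coupling formula); DrewitzPrevostRodriguez2025 =
doi:10.1007/s00440-025-01392-7 Thm 1.1 (ψ(R) ≍ R^{−1/2} on ℤ³);
DGRS2023 = doi:10.1215/00127094-2022-0017 Thm 1.1 (sharpness for discrete GFF level sets). Bib
entries prepared in the unit folder (refs.bib;
`ledger bib add` hung at filing time, keys to be added: Lupu2016, DrewitzPrevostRodriguez2025,
DrewitzPrevostRodriguez2018, DingWirth2020,
DuminilcopinEtAl2023, WeinribHalperin1983, PopovRath2015, RodriguezSznitman2012, MeesterRoy1996,
ChalhoubDrewitzPrevostRodriguez2024,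
DuminilCopinHilarioKozmaSidoravicius2018).

Novelty: Searches (2026-08-15): `lit search --hybrid "Lupu loop clusters random interlacements free field
cable system sign clusters percolation"` (12 local docs, none on
cable-GFF percolation); `lit search --source crossref "one-arm probability metric graph Gaussian
free field"` (15 rows: doi:10.1007/s00440-025-01392-7,
doi:10.1007/s00440-024-01295-z, doi:10.1214/25-aop1775, doi:10.1214/19-aop1397 …); `lit search
--source crossref "Prévost percolation Gaussian free field
cable system counterexamples"` (10 rows: doi:10.1214/23-ejp949, doi:10.1214/23-aap2022, …); `lit
read` of arXiv:1402.0298 (Prop. 4.2 p.14, Prop. 5.5, Thm 3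
verified), doi:10.1007/s00440-025-01392-7 (Thm 1.1), arXiv:2403.18787 (Table I; "crossover to short
range universality classes" open, p. 5),
arXiv:1708.03285, doi:10.1214/23-ejp949, book:meester1996-continuum-percolation (Prop. 3.1, Thm
3.3); `lit frontier CriticalPhenomena --since 2021` (one GFF
row: doi:10.1214/25-aop1775); `lit vsearch "Bernoulli bond percolation in a random environment given
by the GFF …"` (8 books, none relevant);
`lit galaxy search "percolation long-range correlated disorder Weinrib Halperin crossover" --star
all` and `"long-range correlated percolation" --star panama`
(saturated / 8 off-topic book hits, e.g. panama:483063561715717 Sahimi); arXiv/OpenAlex/S2 legs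
rate-limited (HTTP 429) at filing; negatives index read
(1 unrelated SAW refutation); the 9 Theses files and 136 card titles of the sub scanned.
Nearest prior art found: doi:10.1214  [refs: 10.1007/s00440-025-01392-7, 10.1007/s00440-024-01295-z, 10.1214/25-aop1775, 10.1214/19-aop1397, 10.1214/23-ejp949, 10.1214/23-aap2022, 10.1214/15-aop1019, 10.1103/PhysRevB.27.413, 10.1215/00127094-2022-0017, 10.1215/00127094-2020-0036, 1402.0298, 2403.18787, 1708.03285, doi:10.1007/s00440-025-01392-7, doi:10.1007/s00440-024-01295-z, doi:10.1214/25-aop1775, doi:10.1214/19-aop1397, doi:10.1214/23-ej]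

Barriers (technique_class: isomorphism-theorem gaussian-environment crossover): - technique_class: isomorphism-theorem gaussian-environment crossover
- Literature.Barriers.CriticalPhenomena.SlabLimitUniformControl: APPLIES IN SPIRIT and is not evaded
— T1 is a control uniform along a one-parameter family reaching the conjunct, the shape DST call
"roughly of the same difficulty as attacking the problem directly"; the bet is that here the
family's far end is exactly solved with known exponents (one-arm n^{−1/2}), every member σ > 0 is
conjecturally in ONE universality class LR_1 (arXiv:2403.18787), and RayMonotone already gives T1
for m ≤ 0, so uniformity is a crossover statement between two critical theories rather than an
explosion bound at moving critical points of unsolved slabs.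
- Literature.Barriers.CriticalPhenomena.SprinklingRenormalisation: G1 sprinkles in the GFF level /
coupling (Popov–Ráth decoupling) at a FIXED subcritical a < a_c, where paying η > 0 is free; T1 is
not a block construction from θ(p) > 0 and asks for no same-p finite-size criterion; the barrier is
not engaged, and nothing here claims an η = 0 Grimmett–Marstrand step.
- Literature.Barriers.CriticalPhenomena.GaussianDominationRoute: not engaged — no infrared /
two-point upper bound is input or output; the solved end's input is Lupu's isomorphism on the cable
system, and T1's output is a one-arm bound with no rate (consistent with η(3) < 0).
- Literature.Barriers.CriticalPhenomena.LongRangeDiscontinuity: respected — every input is specific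
to the nearest-neighbour GFF of ℤ³ (massl

History (route lifecycle, newest last):
- 2026-08-22T14:01:39Z · DORMANT — reconciler: no traction for 5.4 d (last activity item-evidence-added at 2026-08-17T04:11:12Z); parked, not closed — `ledger route dormant route-CriticalPhenomen (operator:999:2562549)
- 2026-08-23T15:03:10Z · REACTIVATED — reconciler: reactivated — activity statement-closed at 2026-08-23T12:47:57Z after parking at 2026-08-22T14:01:39Z (operator:999:2267357)
- 2026-08-29T05:47:42Z · DORMANT — reconciler: no traction for 5 d (last activity statement-closed at 2026-08-24T03:51:29Z); parked, not closed — `ledger route dormant route-CriticalPhenomena-Per (operator:999:1206846)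

sub-problem: PercolationContinuityZ3 · status: dormant · opened planner-plancard-CriticalPhenomena-Percolatio-dbf1d634-0 2026-08-15T11:58:51Z · rev 2 · ledger route-CriticalPhenomena-PercLupuEnvironment
GENERATED by the gate from the ledger (D-0016/17). Provers cite these decls: `theorem foo : Summit.CriticalPhenomena.PercolationContinuityZ3.Theses.PercLupuEnvironment.<Decl> := …` in Summits/CriticalPhenomena/PercolationContinuityZ3/Theorems/<Name>.lean.
-/

namespace Summit.CriticalPhenomena.PercolationContinuityZ3.Theses.PercLupuEnvironment

open scoped BigOperators Topology Manifold Classical MeasureTheory ProbabilityTheory Matrix InnerProductSpace ComplexConjugate ContinuousMap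
open Filter Set Function TopologicalSpace MeasureTheory

attribute [summit_statement] _root_.PercolationContinuityZ3

/-- item stmt-CriticalPhenomena-6987 · crux · rank 2 · open · by planner
why it might fail: One-arm_n is continuous in m, so T1 forces θ(σ,m_c(σ))=0 at EVERY σ∈(0,σ₀] — open even for discrete-GFF level sets (DGRS 2023 Cor 1.2: decay 'except at criticality') — with n uniform as σ→0, where (σ,m_c(σ)) tends locally to Bernoulli(p_c): the conjunct in disguise. Known only at σ=1 (Lupu; DPR).
sources: doi:10.1214/15-aop1019, doi:10.1007/s00440-025-01392-7, doi:10.1215/00127094-2022-0017, arXiv:2403.18787, doi:10.1103/PhysRevB.27.413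
[crux] (T1; the card's transfer crux N2 in one-arm currency) for every discrete GFF g of ℤ³ there is
σ₀ > 0 such that for every ε > 0 some scale n satisfies: for all 0 < σ ≤ σ₀ and all m with annealed
θ(σ,m) = E P^{m+σg}(|C(0)| = ∞) = 0, the annealed one-arm probability E P^{m+σg}(0 ↔ ∂B(n) in B(n))
is ≤ ε. Equivalently the one-arm probability at the left end m ↑ m_c(σ) of the critical curve tends
to 0 uniformly in σ ≤ σ₀: continuity of the transition at every small disorder strength, uniformly
through the crossover. For m ≤ 0 it already follows from RayMonotone + SolvedEndAnchor (P_{σ,m} ≤_st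
cable level set at level −m/σ ≥ 0, one-arm ≤ C n^{−1/2}); the content is 0 < m < m_c(σ).
[difficulty: open-problem] -/
@[route_item "route-CriticalPhenomena-PercLupuEnvironment"]
def UniformSubcriticalOneArm : Prop :=
  let W : (Literature.Probability.LatticeModels.Site 3 → ℝ) → Sym2 (Literature.Probability.LatticeModels.Site 3) → unitInterval := fun ψ e => if e ∈ (Literature.Probability.LatticeModels.zdGraph 3).edgeSet then Set.projIcc (0 : ℝ) 1 zero_le_one (1 - Real.exp (-2 * (e.map fun x => max (ψ x) 0).mul)) else 0; ∀ (Ω : Type) [MeasurableSpace Ω] (P : MeasureTheory.Measure Ω) [MeasureTheory.IsProbabilityMeasure P] (g : Literature.Probability.LatticeModels.Site 3 → Ω → ℝ), ProbabilityTheory.IsGaussianProcess g P → (∀ x, ∫ ω, g x ω ∂P = 0) → (∀ x y, ∫ ω, g x ω * g y ω ∂P = Literature.Probability.LatticeModels.latticeGreen (d := 3) (x - y) / 2) → ∃ σ₀ : ℝ, 0 < σ₀ ∧ ∀ ε : ℝ, 0 < ε → ∃ n : ℕ, ∀ σ : ℝ, 0 < σ → σ ≤ σ₀ → ∀ m : ℝ,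 ∫ ω, (Literature.Probability.LatticeModels.prodBernoulli (W (fun x => m + σ * g x ω))).real (Literature.Probability.Percolation.percolatesAt (0 : Literature.Probability.LatticeModels.Site 3)) ∂P = 0 → ∫ ω, (Literature.Probability.LatticeModels.prodBernoulli (W (fun x => m + σ * g x ω))).real (Literature.Probability.Percolation.siteToBoundary 3 n) ∂P ≤ ε

/-- item stmt-CriticalPhenomena-6988 · crux · rank 3 · open · by planner
why it might fail: For every σ>0 the GFF stays ≥δ/σ along corridors of length N at cost only exp(−(π/6)(δ/σ−h_*)²N/log N) (GRS 2022 Thm 1.1), cheaper than the e^{−N/ξ} subcritical bulk: supercritical corridors of all lengths exist, one-scale Peierls fails; correlated columnar enhancement shifts p_c (Brochette Thm 1).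
sources: doi:10.1214/22-aop1569, doi:10.1007/s00220-012-1649-y, doi:10.1007/s10955-015-1187-z, arXiv:1608.04963, book:meester1996-continuum-percolation, AizenmanGrimmett1991
[crux] (G1) for every discrete GFF g of ℤ³ and every a > 0 with 1 − e^{−2a²} < p_c(ℤ³) there is σ₁ >
0 such that for all 0 < σ < σ₁ the annealed Lupu model with field a + σg does not percolate: E
P^{a+σg}(|C(0)| = ∞) = 0. In words: weak GFF disorder cannot make subcritical Bernoulli percolation
percolate, liminf_{σ→0} m_c(σ) ≥ a_c — the σ → 0 end of the critical curve does not undershoot p_c.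
Intended proof: coarse-grain at scale L; blocks where sup σ|g| > δ are GFF large-deviation rare
(capacity cost ~ δ²L/(σ² log L)) and sprinkled-decoupled; elsewhere densities stay ≤ 1−e^{−2(a+δ)²}
< p_c; a multiscale "subcritical sea + sparse finite islands" argument. [difficulty: L] -/
@[route_item "route-CriticalPhenomena-PercLupuEnvironment"]
def SubcriticalDisorderStability : Prop :=
  let W : (Literature.Probability.LatticeModels.Site 3 → ℝ) → Sym2 (Literature.Probability.LatticeModels.Site 3) → unitInterval := fun ψ e => if e ∈ (Literature.Probability.LatticeModels.zdGraph 3).edgeSet then Set.projIcc (0 : ℝ) 1 zero_le_one (1 - Real.exp (-2 * (e.map fun x => max (ψ x) 0).mul)) else 0; ∀ (Ω : Type) [MeasurableSpace Ω] (P : MeasureTheory.Measure Ω) [MeasureTheory.IsProbabilityMeasure P] (g : Literature.Probability.LatticeModels.Site 3 → Ω → ℝ), ProbabilityTheory.IsGaussianProcess g P → (∀ x, ∫ ω, g x ω ∂P = 0) → (∀ x y, ∫ ω, g x ω * g y ω ∂P = Literature.Probability.LatticeModels.latticeGreen (d := 3) (x - y) / 2) → ∀ a : ℝ, 0 < a →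 1 - Real.exp (-2 * a ^ 2) < Literature.Probability.Percolation.criticalProb (Literature.Probability.LatticeModels.zdGraph 3) (0 : Literature.Probability.LatticeModels.Site 3) → ∃ σ₁ : ℝ, 0 < σ₁ ∧ ∀ σ : ℝ, 0 < σ → σ < σ₁ → ∫ ω, (Literature.Probability.LatticeModels.prodBernoulli (W (fun x => a + σ * g x ω))).real (Literature.Probability.Percolation.percolatesAt (0 : Literature.Probability.LatticeModels.Site 3)) ∂P = 0

/-- item stmt-CriticalPhenomena-6989 · support · rank 9 · closed · proved by Summit.CriticalPhenomena.PercolationContinuityZ3.Theorems.LupuLocalContinuity.localContinuityAtZero_proof @ 7445f771cf92 (prover) · by planner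
sources: Grimmett1999
[support] for every GFF g, every a ∈ ℝ and n ∈ ℕ: σ ↦ E P^{a+σg}(0 ↔ ∂B(n) in B(n)) tends, as σ →
0⁺, to P^{a}(0 ↔ ∂B(n) in B(n)) (constant field). Dominated convergence: the event is local, its
quenched probability is a polynomial in finitely many weights, each continuous in the field values.
[difficulty: provable-now] -/
@[route_item "route-CriticalPhenomena-PercLupuEnvironment"]
def LocalContinuityAtZero : Prop :=
  let W : (Literature.Probability.LatticeModels.Site 3 → ℝ) → Sym2 (Literature.Probability.LatticeModels.Site 3) → unitInterval := fun ψ e => if e ∈ (Literature.Probability.LatticeModels.zdGraph 3).edgeSet then Set.projIcc (0 : ℝ) 1 zero_le_one (1 - Real.exp (-2 * (e.map fun x => max (ψ x) 0).mul)) else 0; ∀ (Ω : Type) [MeasurableSpace Ω] (P : MeasureTheory.Measure Ω) [MeasureTheory.IsProbabilityMeasure P] (g : Literature.Probability.LatticeModels.Site 3 → Ω → ℝ), ProbabilityTheory.IsGaussianProcess g P → (∀ x, ∫ ω, g x ω ∂P = 0) → (∀ x y, ∫ ω, g x ω * g y ω ∂P = Literature.Probability.LatticeModels.latticeGreen (d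 := 3) (x - y) / 2) → ∀ (a : ℝ) (n : ℕ), Filter.Tendsto (fun σ : ℝ => ∫ ω, (Literature.Probability.LatticeModels.prodBernoulli (W (fun x => a + σ * g x ω))).real (Literature.Probability.Percolation.siteToBoundary 3 n) ∂P) (nhdsWithin 0 (Set.Ioi 0)) (nhds ((Literature.Probability.LatticeModels.prodBernoulli (W (fun _ => a))).real (Literature.Probability.Percolation.siteToBoundary 3 n)))

-- `LocalContinuityAtZero` holds: proved by `Summit.CriticalPhenomena.PercolationContinuityZ3.Theorems.LupuLocalContinuity.localContinuityAtZero_proof` @ 7445f771cf92 (its module imports this route file, so no `_holds` link can be stated here).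

/-- item stmt-CriticalPhenomena-6990 · support · rank 9 · closed · proved by Summit.CriticalPhenomena.PercolationContinuityZ3.Theorems.PercLupuEnvironmentConstantFieldIsBernoulli.constantFieldIsBernoulli_proof @ 43eee089a40d (prover) · by planner
sources: doi:10.1214/15-aop1019, Grimmett1999
[support] the constant field a gives Bernoulli bond percolation on ℤ³ with parameter 1 − e^{−2
a⁺a⁺}: prodBernoulli of the Lupu weights of the constant field equals bondPercolation (zdGraph 3) (1
− e^{−2 a⁺ a⁺}) (via Literature prodBernoulli_indicator_holds). [difficulty: provable-now] -/
@[route_item "route-CriticalPhenomena-PercLupuEnvironment"]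
def ConstantFieldIsBernoulli : Prop :=
  let W : (Literature.Probability.LatticeModels.Site 3 → ℝ) → Sym2 (Literature.Probability.LatticeModels.Site 3) → unitInterval := fun ψ e => if e ∈ (Literature.Probability.LatticeModels.zdGraph 3).edgeSet then Set.projIcc (0 : ℝ) 1 zero_le_one (1 - Real.exp (-2 * (e.map fun x => max (ψ x) 0).mul)) else 0; ∀ a : ℝ, Literature.Probability.LatticeModels.prodBernoulli (W (fun _ => a)) = Literature.Probability.Percolation.bondPercolation (Literature.Probability.LatticeModels.zdGraph 3) (Set.projIcc (0 : ℝ) 1 zero_le_one (1 - Real.exp (-2 * (max a 0 * max a 0))))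

-- `ConstantFieldIsBernoulli` holds: proved by `Summit.CriticalPhenomena.PercolationContinuityZ3.Theorems.PercLupuEnvironmentConstantFieldIsBernoulli.constantFieldIsBernoulli_proof` @ 43eee089a40d (its module imports this route file, so no `_holds` link can be stated here).

/-- item stmt-CriticalPhenomena-6991 · support · rank 9 · closed · proved by Summit.CriticalPhenomena.PercolationContinuityZ3.Theorems.PercLupuEnvironmentOneArmContinuousInP.oneArmContinuousInP_proof @ 3a592c63e608 (prover) · by planner
sources: Grimmett1999
[support] for each n, p ↦ P_p(0 ↔ ∂B(n) in B(n)) is continuous on [0,1] (local increasing event: a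
polynomial in p). [difficulty: provable-now] -/
@[route_item "route-CriticalPhenomena-PercLupuEnvironment"]
def OneArmContinuousInP : Prop :=
  ∀ n : ℕ, Continuous fun p : unitInterval => (Literature.Probability.Percolation.bondPercolation (Literature.Probability.LatticeModels.zdGraph 3) p).real (Literature.Probability.Percolation.siteToBoundary 3 n)

-- `OneArmContinuousInP` holds: proved by `Summit.CriticalPhenomena.PercolationContinuityZ3.Theorems.PercLupuEnvironmentOneArmContinuousInP.oneArmContinuousInP_proof` @ 3a592c63e608 (its module imports this route file, so no `_holds` link can be stated here).

/-- item stmt-CriticalPhenomena-6992 · support · rank 9 · closed · proved by Summit.CriticalPhenomena.PercolationContinuityZ3.Theorems.LupuEnvironmentGFFExists.gffExists_proof @ 407af72c445a (prover) · by planner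
sources: doi:10.1007/s00220-012-1649-y, doi:10.1214/15-aop1019
[support] some probability space carries a centred Gaussian process (g_x), x ∈ ℤ³, with E g_x g_y =
latticeGreen(x−y)/2 — the discrete GFF of ℤ³ with unit conductances (latticeGreen/2 = (−L)⁻¹ is
positive definite by its Fourier representation with symbol 1/(2Σᵢ(1−cos kᵢ)); construct g_x = Σ_y
K(x−y)ξ_y with K̂ = Ĝ^{1/2} ∈ L²(𝕋³) and ξ i.i.d. N(0,1), or by Kolmogorov extension). Makes the
∀-quantified cruxes non-vacuous; used by the assembly. [difficulty: M] -/
@[route_item "route-CriticalPhenomena-PercLupuEnvironment"]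
def GFFExists : Prop :=
  ∃ (Ω : Type) (_ : MeasurableSpace Ω) (P : MeasureTheory.Measure Ω) (_ : MeasureTheory.IsProbabilityMeasure P) (g : Literature.Probability.LatticeModels.Site 3 → Ω → ℝ), ProbabilityTheory.IsGaussianProcess g P ∧ (∀ x, ∫ ω, g x ω ∂P = 0) ∧ ∀ x y, ∫ ω, g x ω * g y ω ∂P = Literature.Probability.LatticeModels.latticeGreen (d := 3) (x - y) / 2

-- `GFFExists` holds: proved by `Summit.CriticalPhenomena.PercolationContinuityZ3.Theorems.LupuEnvironmentGFFExists.gffExists_proof` @ 407af72c445a (its module imports this route file, so no `_holds` link can be stated here).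

/-- item stmt-CriticalPhenomena-6993 · support · rank 9 · closed · proved by Summit.CriticalPhenomena.PercolationContinuityZ3.Theorems.PercLupuEnvironmentRayMonotone.rayMonotone_proof @ 368fd47807bb (prover) · by planner
sources: doi:10.1214/15-aop1019, Grimmett1999
[support] (structure of the family) for every field ψ, every c ≥ 1, t ≥ 0 and every increasing
measurable event A: P^{W(ψ)}(A) ≤ P^{W(cψ+t)}(A), because the Lupu weights 1−e^{−2ψ_x⁺ψ_y⁺} are
pointwise monotone under ψ ↦ cψ + t (prodBernoulli_real_mono_of_isUpperSet). Hence in the chart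
(κ,h) = (σ², m/σ) the family is increasing in both parameters, m_c(σ) ≥ 0 on (0,1], and P_{σ,m} ≤_st
(cable level set at level −m/σ) for σ ≤ 1. [difficulty: provable-now] -/
@[route_item "route-CriticalPhenomena-PercLupuEnvironment"]
def RayMonotone : Prop :=
  let W : (Literature.Probability.LatticeModels.Site 3 → ℝ) → Sym2 (Literature.Probability.LatticeModels.Site 3) → unitInterval := fun ψ e => if e ∈ (Literature.Probability.LatticeModels.zdGraph 3).edgeSet then Set.projIcc (0 : ℝ) 1 zero_le_one (1 - Real.exp (-2 * (e.map fun x => max (ψ x) 0).mul)) else 0; ∀ (ψ : Literature.Probability.LatticeModels.Site 3 → ℝ) (c t : ℝ), 1 ≤ c → 0 ≤ t → ∀ A : Set (Literature.Probability.Percolation.BondConfig (Literature.Probability.LatticeModels.Site 3)), IsUpperSet A → MeasurableSet A → (Literature.Probability.LatticeModels.prodBernoulli (W ψ)).real A ≤ (Literature.Probability.LatticeModels.prodBernoulli (W (fun x => c * ψ x + t))).real A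

-- `RayMonotone` holds: proved by `Summit.CriticalPhenomena.PercolationContinuityZ3.Theorems.PercLupuEnvironmentRayMonotone.rayMonotone_proof` @ 368fd47807bb (its module imports this route file, so no `_holds` link can be stated here).

/-- item stmt-CriticalPhenomena-6994 · support · rank 9 · open · by planner
sources: doi:10.1214/15-aop1019, doi:10.1007/s00220-018-3209-6, doi:10.1007/s00440-025-01392-7, doi:10.1214/19-aop1397
[support] (calibration of the formal model against the solved end σ = 1) for every GFF g: (i)
annealed θ(1,0) = 0 (Lupu 2016 Prop. 5.5: the sign clusters of the cable GFF of ℤ̃^d, d ≥ 3, are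
bounded); (ii) θ(1,m) > 0 for every m > 0 (Lupu 2016 Thm 3, DPR 2018 (1.10): {φ̃ ≥ −h} percolates
for h > 0); (iii) E P^{g}(0 ↔ ∂B(n) in B(n)) ≤ C n^{−1/2} (Drewitz–Prévost–Rodriguez 2025 Thm 1.1
with ν = 1; Ding–Wirth 2020 with a log). A refutation would mean the Lean rendering of the family is
wrong (repair by restate), not that the line is dead; a proof needs the isomorphism theory in
Literature (cite requests below). [difficulty: XL] -/
@[route_item "route-CriticalPhenomena-PercLupuEnvironment"]
def SolvedEndAnchor : Prop :=
  let W : (Literature.Probability.LatticeModels.Site 3 → ℝ) → Sym2 (Literature.Probability.LatticeModels.Site 3) → unitInterval := fun ψ e => if e ∈ (Literature.Probability.LatticeModels.zdGraph 3).edgeSet then Set.projIcc (0 : ℝ) 1 zero_le_one (1 - Real.exp (-2 * (e.map fun x => max (ψ x) 0).mul)) else 0; ∀ (Ω : Type) [MeasurableSpace Ω] (P : MeasureTheory.Measure Ω) [MeasureTheory.IsProbabilityMeasure P] (g : Literature.Probability.LatticeModels.Site 3 → Ω → ℝ), ProbabilityTheory.IsGaussianProcess g P → (∀ x, ∫ ω,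 g x ω ∂P = 0) → (∀ x y, ∫ ω, g x ω * g y ω ∂P = Literature.Probability.LatticeModels.latticeGreen (d := 3) (x - y) / 2) → (∫ ω, (Literature.Probability.LatticeModels.prodBernoulli (W (fun x => g x ω))).real (Literature.Probability.Percolation.percolatesAt (0 : Literature.Probability.LatticeModels.Site 3)) ∂P = 0) ∧ (∀ m : ℝ, 0 < m → 0 < ∫ ω, (Literature.Probability.LatticeModels.prodBernoulli (W (fun x => m + g x ω))).real (Literature.Probability.Percolation.percolatesAt (0 : Literature.Probability.LatticeModels.Site 3)) ∂P) ∧ ∃ C : ℝ, ∀ n : ℕ, 1 ≤ n → ∫ ω, (Literature.Probability.LatticeModels.prodBernoulli (W (fun x => g x ω))).real (Literature.Probability.Percolation.siteToBoundary 3 n) ∂P ≤ C * (n : ℝ) ^ (-(1 / 2 : ℝ))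

/-- item stmt-CriticalPhenomena-6995 · assembly · rank 1 · closed · proved by Summit.CriticalPhenomena.PercolationContinuityZ3.Theorems.PercLupuEnvironmentAssembly.assembly_proof @ 3a592c63e608 (prover) · by planner
sources: Grimmett1999, doi:10.1214/15-aop1019
[assembly] LocalContinuityAtZero → ConstantFieldIsBernoulli → OneArmContinuousInP → GFFExists →
SubcriticalDisorderStability → UniformSubcriticalOneArm → PercolationContinuityZ3 (the conjunct
constant, root-level abbrev of Literature.Probability.Percolation.PercolationContinuityZ3). -/
@[route_item "route-CriticalPhenomena-PercLupuEnvironment"]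
def Assembly : Prop :=
  LocalContinuityAtZero → ConstantFieldIsBernoulli → OneArmContinuousInP → GFFExists → SubcriticalDisorderStability → UniformSubcriticalOneArm → PercolationContinuityZ3

-- `Assembly` holds: proved by `Summit.CriticalPhenomena.PercolationContinuityZ3.Theorems.PercLupuEnvironmentAssembly.assembly_proof` @ 3a592c63e608 (its module imports this route file, so no `_holds` link can be stated here).

/-! D-0027 §2.1 — DECIDING THEOREM (planner-authored via `route open/edit --closes-file`; by planner-rbadge-CriticalPhenomena-PercLupuEnvir-3f43014c-g4-0 2026-08-15T16:20:03Z):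
its hypotheses are this route's items and its conclusion the sub-problem Statement (glue_lint), and it elaborates with this file. -/

@[closes "route-CriticalPhenomena-PercLupuEnvironment"] theorem closes : LocalContinuityAtZero → ConstantFieldIsBernoulli → OneArmContinuousInP → GFFExists → SubcriticalDisorderStability → UniformSubcriticalOneArm → _root_.PercolationContinuityZ3 := by
  intro hLC hCF hCont hGFF hG1 hT1
  -- Unfold the sub-problem statement: θ_{ℤ³}(p_c) = 0.
  show Literature.Probability.Percolation.theta (Literature.Probability.LatticeModels.zdGraph 3)
      (0 : Literature.Probability.LatticeModels.Site 3) (Literature.Probability.Percolation.criticalProbI 3) = 0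
  have hc01 := Literature.Probability.Percolation.criticalProb_mem_Icc
    (Literature.Probability.LatticeModels.zdGraph 3) (0 : Literature.Probability.LatticeModels.Site 3)
  -- θ(p) ≤ P_p(0 ↔ ∂B(n) in B(n)) for every p and n (first exit of an infinite cluster from the box).
  have theta_le : ∀ (p : unitInterval) (n : ℕ),
      Literature.Probability.Percolation.theta (Literature.Probability.LatticeModels.zdGraph 3)
        (0 : Literature.Probability.LatticeModels.Site 3) p ≤
      (Literature.Probability.Percolation.bondPercolation (Literature.Probability.LatticeModels.zdGraph 3) p).real
        (Literature.Probability.Percolation.siteToBoundary 3 n) := by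
    intro p n
    have hae : ∀ᵐ ω ∂(Literature.Probability.Percolation.bondPercolation (Literature.Probability.LatticeModels.zdGraph 3) p),
        ω ∈ Literature.Probability.Percolation.percolatesAt (0 : Literature.Probability.LatticeModels.Site 3) →
        ω ∈ Literature.Probability.Percolation.siteToBoundary 3 n := by
      have hsub : ∀ᵐ ω ∂(Literature.Probability.Percolation.bondPercolation (Literature.Probability.LatticeModels.zdGraph 3) p),
          ω ⊆ (Literature.Probability.LatticeModels.zdGraph 3).edgeSet :=
        ProbabilityTheory.setBernoulli_ae_subset
      filter_upwards [hsub] with ω hω hperc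
      have hinf : (Literature.Probability.Percolation.openCluster ω (0 : Literature.Probability.LatticeModels.Site 3)).Infinite := hperc
      obtain ⟨z, hz, hzn⟩ := hinf.exists_notMem_finset (Literature.Probability.LatticeModels.box 3 n)
      have hz' : (Literature.Probability.Percolation.openGraph ω).Reachable 0 z := hz
      obtain ⟨W⟩ := hz'
      -- first exit from the box along an open walk
      have main : ∀ (u v : Literature.Probability.LatticeModels.Site 3)
          (W : (Literature.Probability.Percolation.openGraph ω).Walk u v),
          v ∉ Literature.Probability.LatticeModels.box 3 n → ∀ hu : u ∈ Literature.Probability.LatticeModels.box 3 n,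
          ∃ (y : Literature.Probability.LatticeModels.Site 3) (hy : y ∈ Literature.Probability.LatticeModels.box 3 n),
            (∃ y', y' ∉ Literature.Probability.LatticeModels.box 3 n ∧ (Literature.Probability.Percolation.openGraph ω).Adj y y') ∧
            ((Literature.Probability.Percolation.openGraph ω).induce
              (↑(Literature.Probability.LatticeModels.box 3 n) : Set (Literature.Probability.LatticeModels.Site 3))).Reachable
              ⟨u, hu⟩ ⟨y, hy⟩ := by
        intro u v W
        induction W with
        | nil => intro hvn hu; exact absurd hu hvn
        | @cons a b c hadj W' ih =>
          intro hcn ha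
          by_cases hb : b ∈ Literature.Probability.LatticeModels.box 3 n
          · obtain ⟨y, hy, hy', hreach⟩ := ih hcn hb
            refine ⟨y, hy, hy', ?_⟩
            have hadj' : ((Literature.Probability.Percolation.openGraph ω).induce
                (↑(Literature.Probability.LatticeModels.box 3 n) : Set (Literature.Probability.LatticeModels.Site 3))).Adj
                ⟨a, ha⟩ ⟨b, hb⟩ := SimpleGraph.induce_adj.2 hadj
            exact hadj'.reachable.trans hreach
          · exact ⟨a, ha, ⟨b, hb, hadj⟩, SimpleGraph.Reachable.refl _⟩
      obtain ⟨y, hy, ⟨y', hy', hadj⟩, hreach⟩ := main 0 z W hzn (Literature.Probability.LatticeModels.zero_mem_box 3 n)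
      refine ⟨y, ?_, ?_⟩
      · rw [Literature.Probability.LatticeModels.mem_innerBoundary_iff]
        refine ⟨hy, y', hy', ?_⟩
        have h1 : s(y, y') ∈ ω := ((Literature.Probability.Percolation.openGraph_adj ω y y').1 hadj).1
        exact (SimpleGraph.mem_edgeSet _).1 (hω h1)
      · exact ⟨Literature.Probability.LatticeModels.zero_mem_box 3 n, hy, hreach⟩
    exact ENNReal.toReal_mono (MeasureTheory.measure_ne_top _ _) (MeasureTheory.measure_mono_ae hae)
  rcases hc01.1.eq_or_lt with hc0 | hc0
  · -- degenerate case p_c = 0: θ(0) = 0 (every edge closed)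
    have h0 : Literature.Probability.Percolation.criticalProbI 3 = 0 :=
      Subtype.ext (by rw [Literature.Probability.Percolation.coe_criticalProbI]; exact hc0.symm)
    rw [h0]
    exact Literature.Probability.Percolation.theta_bot _ _
  -- main case 0 < p_c: fix a discrete GFF and the uniform scale from T1
  obtain ⟨Ω, _mΩ, P, _hP, g, hGauss, hmean, hcov⟩ := hGFF
  obtain ⟨σ₀, hσ₀, Hε⟩ := hT1 Ω P g hGauss hmean hcov
  refine le_antisymm (le_of_forall_pos_le_add fun ε hε => ?_) MeasureTheory.measureReal_nonneg
  rw [zero_add]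
  obtain ⟨n, Hn⟩ := Hε ε hε
  -- for every p ∈ (0, p_c): P_p(0 ↔ ∂B(n) in B(n)) ≤ ε, via the level a = (−log(1−p)/2)^{1/2}
  have key : ∀ p : ℝ, 0 < p → p < Literature.Probability.Percolation.criticalProb (Literature.Probability.LatticeModels.zdGraph 3) (0 : Literature.Probability.LatticeModels.Site 3) →
      (Literature.Probability.Percolation.bondPercolation (Literature.Probability.LatticeModels.zdGraph 3)
        (Set.projIcc (0 : ℝ) 1 zero_le_one p)).real (Literature.Probability.Percolation.siteToBoundary 3 n) ≤ ε := by
    intro p hp0 hpc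
    have hp1 : p < 1 := hpc.trans_le hc01.2
    have hApos : 0 < -Real.log (1 - p) / 2 := by
      have := Real.log_neg (by linarith : 0 < 1 - p) (by linarith)
      linarith
    obtain ⟨a, ha_def⟩ : ∃ a : ℝ, a = Real.sqrt (-Real.log (1 - p) / 2) := ⟨_, rfl⟩
    have ha : 0 < a := by rw [ha_def]; exact Real.sqrt_pos.2 hApos
    have hasq : a ^ 2 = -Real.log (1 - p) / 2 := by rw [ha_def]; exact Real.sq_sqrt hApos.le
    have hexp : Real.exp (-2 * a ^ 2) = 1 - p := by
      rw [hasq, show -2 * (-Real.log (1 - p) / 2) = Real.log (1 - p) by ring]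
      exact Real.exp_log (by linarith)
    have hpa : 1 - Real.exp (-2 * a ^ 2) = p := by rw [hexp]; ring
    have hpa' : 1 - Real.exp (-2 * (max a 0 * max a 0)) = p := by
      rw [max_eq_left ha.le, ← pow_two, hexp]; ring
    have hlt : 1 - Real.exp (-2 * a ^ 2) <
        Literature.Probability.Percolation.criticalProb (Literature.Probability.LatticeModels.zdGraph 3)
          (0 : Literature.Probability.LatticeModels.Site 3) := by rw [hpa]; exact hpc
    -- G1: the annealed model at level a does not percolate for small disorder
    obtain ⟨σ₁, hσ₁, H1⟩ := hG1 Ω P g hGauss hmean hcov a ha hlt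
    -- T1 on (0, min σ₀ σ₁), then σ → 0⁺ by local continuity
    have hev : Set.Ioo (0 : ℝ) (min σ₀ σ₁) ∈ 𝓝[>] (0 : ℝ) := Ioo_mem_nhdsGT (lt_min hσ₀ hσ₁)
    have hle := le_of_tendsto (hLC Ω P g hGauss hmean hcov a n)
      (Filter.mem_of_superset hev fun σ hσ =>
        Hn σ hσ.1 (hσ.2.le.trans (min_le_left _ _)) a (H1 σ hσ.1 (hσ.2.trans_le (min_le_right _ _))))
    rw [hCF a, hpa'] at hle
    exact hle
  -- continuity in p carries the bound to p = p_c
  have hcont : Continuous fun p : ℝ =>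
      (Literature.Probability.Percolation.bondPercolation (Literature.Probability.LatticeModels.zdGraph 3)
        (Set.projIcc (0 : ℝ) 1 zero_le_one p)).real (Literature.Probability.Percolation.siteToBoundary 3 n) :=
    (hCont n).comp continuous_projIcc
  have hclosed := isClosed_le hcont continuous_const (g := fun _ : ℝ => ε)
  have hsub : Set.Ioo (0 : ℝ) (Literature.Probability.Percolation.criticalProb (Literature.Probability.LatticeModels.zdGraph 3) (0 : Literature.Probability.LatticeModels.Site 3)) ⊆
      {p : ℝ | (Literature.Probability.Percolation.bondPercolation (Literature.Probability.LatticeModels.zdGraph 3)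
        (Set.projIcc (0 : ℝ) 1 zero_le_one p)).real (Literature.Probability.Percolation.siteToBoundary 3 n) ≤ ε} :=
    fun p hp => key p hp.1 hp.2
  have hcmem : Literature.Probability.Percolation.criticalProb (Literature.Probability.LatticeModels.zdGraph 3) (0 : Literature.Probability.LatticeModels.Site 3) ∈
      closure (Set.Ioo (0 : ℝ) (Literature.Probability.Percolation.criticalProb (Literature.Probability.LatticeModels.zdGraph 3) (0 : Literature.Probability.LatticeModels.Site 3))) := by
    rw [closure_Ioo hc0.ne]
    exact ⟨hc0.le, le_rfl⟩
  have hcε := hclosed.closure_subset_iff.mpr hsub hcmem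
  have hproj : Set.projIcc (0 : ℝ) 1 zero_le_one
      (Literature.Probability.Percolation.criticalProb (Literature.Probability.LatticeModels.zdGraph 3) (0 : Literature.Probability.LatticeModels.Site 3)) =
      Literature.Probability.Percolation.criticalProbI 3 := by
    rw [Set.projIcc_of_mem zero_le_one hc01]
    rfl
  simp only [Set.mem_setOf_eq, hproj] at hcε
  exact (theta_le _ n).trans hcε

end Summit.CriticalPhenomena.PercolationContinuityZ3.Theses.PercLupuEnvironment
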